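import Literature.Probability.Percolation.FourArmGarbanCrossingBridge
import Literature.Probability.Percolation.FourArmGarbanShift
import Literature.Probability.Percolation.ZdPivotalFourArm
import Literature.Probability.Percolation.RSWLemma
import Literature.Probability.Percolation.PivotalCell
import HarnessLib

/-!
# Garban's block-pivotality of a mesoscopic square and its four arms

Topic `Literature/Probability/Percolation`; support file for the named fact
`Literature.Probability.Percolation.Garban2011_fourArm_multiscale` (`FourArmGarban.lean`;
C. Garban, Appendix B of O. Schramm, S. Smirnov, Ann. Probab. 39 (2011), Lemma B.1). Bond
percolation on `ℤ²`. Two definitions (`boxPivotal`, the geometric predicate `BoxInside`), no named fact.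

Garban (SS11 App. B, proof of Lemma B.1): "Given a percolation configuration `ω`, we say that
`Q_j` is pivotal for `X`, if altering `ω` so that all the bonds in `Q_j` are open, and so that all
the bonds in `Q_j` are closed yields two different values of `X`. Note that `Q_j` is pivotal for
`X` if and only if there are two open arms connecting `∂Q_j` to `∂₀Q` and `∂₂Q`, and two dual
closed arms connecting `∂Q_j` to `∂₁Q` and `∂₃Q`." With the tree's rendering of Garban's square
`Q = {0, …, L}²` (`squareDobrushin L`, `∂₀Q` = the wired left column) and of "`Q` is crossed"
(`squareReach L`, `FourArmGarbanCrossingEvent.lean`: an open walk of the square from the left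
column to `{x₀ = L-1}`, `X = crossingSign = 2·1_{squareReach} - 1`), this file defines and studies

* `boxPivotal L c t` — **the block `c + B(t)` is pivotal for `X`**:
  `squareReach L (ω ∪ boxPairs c t) ∧ ¬ squareReach L (ω ∖ boxPairs c t)` (`boxPairs c t` = the
  pairs of sites of `c + B(t)`, `FourArmGarbanConditional.lean`);
* `mem_boxPivotal_iff_isPivotalOn` — this is the tree's general notion `IsPivotalOn`
  (`PivotalCell.lean`, Garban–Pete–Schramm's pivotal boxes) of the pairs `boxPairs c t` for the
  increasing event `{squareReach L}`, written in monotone form;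
* `boxPivotal_mono` — **monotonicity in the block**: a pivotal block stays pivotal when
  enlarged (`t' ≤ t → boxPivotal L c t' ⊆ boxPivotal L c t`, from `IsPivotalOn.mono`) — the
  elementary fact driving the pigeonhole over thin scales in the docking step of (B.4);
* `sdiff_union_mem_boxPivotal_iff`, `measurableSet_boxPivotal` — block-pivotality is an
  event determined by the edges OFF the block;
* `BoxInside n c r` — the standing geometric assumption `c + B(r) ⊆ [1, 4n-2]²`
  (`r + 1 ≤ cᵢ`, `cᵢ + r + 2 ≤ 4n`) and its elementary consequences (sites of `c + B(r)` are
  interior sites of the square; genuinely open edges there are completed-open and conversely);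
* `exists_crossing_subwalk_at` — a walk from outside `c + B(b')` into `c + B(a'-1)` crosses the
  annulus `c + A_{a',b'}` along itself (the recentred `exists_crossing_subwalk` of
  `InwardDocking.lean`);
* `boxPivotal_subset_fourArmTwoClustersAt` — **a pivotal block carries four alternating arms**
  (Garban's "if and only if", the direction `⇒`, in the cluster form of `FourArmGarban.lean`):
  for a lattice configuration, `boxPivotal (4n) c t ⊆ fourArmTwoClustersAt c (t+1) n'` whenever
  `t + 1 ≤ n'` and `c + B(n')` lies inside `[1, L-2] × [1, L-2]`; hence
  `P(boxPivotal (4n) c t) ≤ P(fourArmTwoClusters (t+1) n')` (`real_boxPivotal_le`).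

The converse comparison `P(boxPivotal) ≳ P⁴` is Garban's (B.2), Kesten's arm separation, and is
NOT treated here.

## References

* O. Schramm, S. Smirnov (appendix by C. Garban), Ann. Probab. 39 (2011), Appendix B, proof of
  Lemma B.1 (definition of "`Q_j` pivotal for `X`" and the sentence after it) [SchrammSmirnov2011].
* P. Nolin, Electron. J. Probab. 13 (2008), §4.2 Remark 9 (pivotality = four arms with the sides
  as landing areas) [Nolin2008].

Tree: `squareReach`, `squareReach_mono`, `reveals_rightPairs_iff_squareReach`
(`FourArmGarbanCrossingEvent.lean`), `mem_bcBondConfig_squareDobrushin`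
(`FourArmGarbanCrossingBridge.lean`), `mem_zdArcA_squareDobrushin_iff`,
`mem_zdArcB_squareDobrushin_iff`, `squareSites` (`FourArmGarbanSquareDomain.lean`), `boxPairs`,
`mem_boxPairs_iff`, `boxPairs_mono` (`FourArmGarbanConditional.lean`), `fourArmTwoClustersAt`,
`real_fourArmTwoClustersAt` (`FourArmGarbanShift.lean`), `exists_prefix_exit`
(`FourArmGarbanTwoArms.lean`), `exists_prefix_first_mem` (`RSWLemma.lean`),
`ZdPivotal.sub_mem_box_succ_of_adj` (`ZdPivotalFourArm.lean`), `measurableSet_reveals`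
(`FourArmGarbanOrthogonality.lean`), `exists_walk_of_mem_openConnIn`, `mem_openConnIn_of_walk`
(`PlanarDuality.lean`), `ae_subset_edgeSet` (`RSW.lean`).
-/

noncomputable section

namespace Literature.Probability.Percolation

open _root_.MeasureTheory Set LatticeModels LatticeModels.DiscreteDobrushin

/-! ### Completed configurations and `squareReach` depend only on the edges used -/

/-- The completed (boundary-condition) status of a pair depends on the configuration only through
the membership of that pair. [folklore] -/
theorem mem_bcBondConfig_congr (D : DiscreteDobrushin) {ω ω' : BondConfig (Site 2)}
    {e : Sym2 (Site 2)} (h : e ∈ ω ↔ e ∈ ω') : e ∈ D.bcBondConfig ω ↔ e ∈ D.bcBondConfig ω' := by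
  simp only [DiscreteDobrushin.mem_bcBondConfig_iff, h]

/-- **Transfer of `squareReach` along its witness**: if `Q` is crossed in `ω` by a walk all of whose
edges have the same status in `ω'`, then `Q` is crossed in `ω'`. [folklore] -/
theorem squareReach_of_walk_congr {L : ℕ} {ω ω' : BondConfig (Site 2)} {a b : Site 2}
    (p : (zdGraph 2).Walk a b) (ha : a 0 = 0) (hb : b 0 + 1 = L)
    (hs : ∀ z ∈ p.support, z ∈ squareSites L ∧ z 0 + 1 ≤ L)
    (he : ∀ e ∈ p.edges, e ∈ (squareDobrushin L).bcBondConfig ω)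
    (hcongr : ∀ e ∈ p.edges, (e ∈ ω ↔ e ∈ ω')) : squareReach L ω' :=
  ⟨a, b, p, ha, hb, hs, fun e he' => (mem_bcBondConfig_congr _ (hcongr e he')).1 (he e he')⟩

/-! ### Block-pivotality -/

/-- **The block `c + B(t)` is pivotal for Garban's crossing variable** ("altering `ω` so that all
the bonds in `Q_j` are open, and so that all the bonds in `Q_j` are closed yields two different
values of `X`"): with all pairs of `c + B(t)` opened the square is crossed, with all of them closed
it is not. [cite: SchrammSmirnov2011, Appendix B, proof of Lemma B.1 (Q_j pivotal for X)] -/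
def boxPivotal (L : ℕ) (c : Site 2) (t : ℕ) : Set (BondConfig (Site 2)) :=
  {ω | squareReach L (ω ∪ boxPairs c t) ∧ ¬ squareReach L (ω \ boxPairs c t)}

/-- Membership in `boxPivotal`, unfolded. [folklore] -/
theorem mem_boxPivotal_iff {L : ℕ} {c : Site 2} {t : ℕ} {ω : BondConfig (Site 2)} :
    ω ∈ boxPivotal L c t ↔ squareReach L (ω ∪ boxPairs c t) ∧ ¬ squareReach L (ω \ boxPairs c t) :=
  Iff.rfl

/-- **`boxPivotal` is the tree's general pivotality `IsPivotalOn` (Garban–Pete–Schramm's "pivotal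
box", `PivotalCell.lean`) of the set of pairs `boxPairs c t` for the increasing crossing event
`{squareReach L}`**, written in monotone form: some configuration agreeing with `ω` off the block
changes the value of `X` iff opening the block crosses `Q` and closing it does not
(`squareReach_mono`). [cite: SchrammSmirnov2011, Appendix B, proof of Lemma B.1 (Q_j pivotal for X)] -/
theorem mem_boxPivotal_iff_isPivotalOn {L : ℕ} {c : Site 2} {t : ℕ} {ω : BondConfig (Site 2)} :
    ω ∈ boxPivotal L c t ↔ IsPivotalOn {ω | squareReach L ω} (boxPairs c t) ω := by
  set B := boxPairs c t with hB
  constructor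
  · rintro ⟨h1, h2⟩
    by_cases hω : squareReach L ω
    · refine ⟨ω \ B, fun e he => ⟨fun h => h.1, fun h => ⟨h, he⟩⟩, ?_⟩
      simp only [mem_setOf_eq, hω, iff_true]
      exact h2
    · refine ⟨ω ∪ B, fun e he => ⟨fun h => h.resolve_right he, fun h => Or.inl h⟩, ?_⟩
      simp only [mem_setOf_eq, hω, iff_false, not_not]
      exact h1
  · rintro ⟨ω', hω', hA⟩
    simp only [mem_setOf_eq] at hA
    have hlo : ω \ B ⊆ ω' := fun e he => (hω' e he.2).2 he.1
    have hhi : ω' ⊆ ω ∪ B := fun e he => by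
      by_cases heB : e ∈ B
      · exact Or.inr heB
      · exact Or.inl ((hω' e heB).1 he)
    by_cases hω : squareReach L ω
    · have hω'n : ¬ squareReach L ω' := fun h => hA ⟨fun _ => hω, fun _ => h⟩
      exact ⟨squareReach_mono L subset_union_left hω, fun h => hω'n (squareReach_mono L hlo h)⟩
    · have hω'y : squareReach L ω' := by
        by_contra h
        exact hA ⟨fun h' => absurd h' h, fun h' => absurd h' hω⟩
      exact ⟨squareReach_mono L hhi hω'y, fun h => hω (squareReach_mono L sdiff_le h)⟩

/-- **A pivotal block stays pivotal when enlarged**: `boxPivotal` is monotone in the radius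
(`IsPivotalOn.mono` with `boxPairs_mono`). [folklore] -/
theorem boxPivotal_mono (L : ℕ) (c : Site 2) {t' t : ℕ} (h : t' ≤ t) :
    boxPivotal L c t' ⊆ boxPivotal L c t := fun _ hω =>
  mem_boxPivotal_iff_isPivotalOn.2 ((mem_boxPivotal_iff_isPivotalOn.1 hω).mono (boxPairs_mono c h))

/-- **Block-pivotality does not depend on the configuration inside the block.** [folklore] -/
theorem sdiff_union_mem_boxPivotal_iff {L : ℕ} {c : Site 2} {t : ℕ} (ω : BondConfig (Site 2))
    {ξ : Set (Sym2 (Site 2))} (hξ : ξ ⊆ boxPairs c t) :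
    ω \ boxPairs c t ∪ ξ ∈ boxPivotal L c t ↔ ω ∈ boxPivotal L c t := by
  have h1 : ω \ boxPairs c t ∪ ξ ∪ boxPairs c t = ω ∪ boxPairs c t := by
    ext e
    have := @hξ e
    simp only [mem_union, mem_sdiff]
    tauto
  have h2 : (ω \ boxPairs c t ∪ ξ) \ boxPairs c t = ω \ boxPairs c t := by
    ext e
    have := @hξ e
    simp only [mem_union, mem_sdiff]
    tauto
  simp only [mem_boxPivotal_iff, h1, h2]

/-- The crossing event `{squareReach (4n)}` is measurable (it is an interface event,
`reveals_rightPairs_iff_squareReach`). [folklore] -/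
theorem measurableSet_squareReach {n : ℕ} (hn : 1 ≤ n) :
    MeasurableSet {ω : BondConfig (Site 2) | squareReach (4 * n) ω} := by
  have h2 : 2 ≤ 4 * n := by omega
  have : {ω : BondConfig (Site 2) | squareReach (4 * n) ω} =
      Reveals (isZdAdmissible_squareDobrushin h2) (rightPairs (4 * n)) := by
    ext ω
    exact (reveals_rightPairs_iff_squareReach h2 ω).symm
  rw [this]
  exact measurableSet_reveals _ _

/-- Adding a fixed set of pairs is a measurable operation. [folklore] -/
theorem measurable_union_const_pairs (S : Set (Sym2 (Site 2))) :
    Measurable fun ω : BondConfig (Site 2) => ω ∪ S :=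
  measurable_set_iff.2 fun e => (measurable_set_mem e).or measurable_const

/-- Removing a fixed set of pairs is a measurable operation. [folklore] -/
theorem measurable_sdiff_const_pairs (S : Set (Sym2 (Site 2))) :
    Measurable fun ω : BondConfig (Site 2) => ω \ S :=
  measurable_set_iff.2 fun e => (measurable_set_mem e).and measurable_const

/-- Block-pivotality is an event. [folklore] -/
theorem measurableSet_boxPivotal {n : ℕ} (hn : 1 ≤ n) (c : Site 2) (t : ℕ) :
    MeasurableSet (boxPivotal (4 * n) c t) :=
  (measurable_union_const_pairs (boxPairs c t) (measurableSet_squareReach hn)).inter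
    (measurable_sdiff_const_pairs (boxPairs c t) (measurableSet_squareReach hn)).compl

/-! ### A walk from outside `c + B(b')` into `c + B(a'-1)` crosses the annulus `c + A_{a',b'}` -/

/-- **An inward walk crosses the recentred annulus along itself** (`exists_crossing_subwalk` of
`InwardDocking.lean` around an arbitrary centre `c`): a lattice walk from `z` with
`z - c ∉ B(b')` to `u` with `u - c ∈ B(a'-1)` (`1 ≤ a' ≤ b'`) contains a segment from a site `x`
with `x - c ∈ {‖·‖_∞ = a'}` to a site `y` with `y - c ∈ {‖·‖_∞ = b'}`, all of whose vertices `v`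
satisfy `v - c ∈ A_{a',b'}`, with vertices and edges among those of the walk. [folklore] -/
theorem exists_crossing_subwalk_at {c : Site 2} {a' b' : ℕ} (ha : 1 ≤ a') (hab : a' ≤ b')
    {z u : Site 2} (P : (zdGraph 2).Walk z u) (hz : z - c ∉ box 2 b') (hu : u - c ∈ box 2 (a' - 1)) :
    ∃ (x y : Site 2) (q : (zdGraph 2).Walk x y), x - c ∈ siteSphere a' ∧ y - c ∈ siteSphere b' ∧
      (∀ v ∈ q.support, v - c ∈ sqAnnulus a' b') ∧ (∀ v ∈ q.support, v ∈ P.support) ∧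
      ∀ e ∈ q.edges, e ∈ P.edges := by
  -- Step 1: the initial segment of `P` outside `c + B(a'-1)`, ending on the sphere `a'`
  have hzA : z ∈ ({v | v - c ∉ box 2 (a' - 1)} : Set (Site 2)) := fun h =>
    hz (box_mono 2 (by omega) h)
  have huA : u ∉ ({v | v - c ∉ box 2 (a' - 1)} : Set (Site 2)) := fun h => h hu
  obtain ⟨x, w, q₁, hxw, hw, hA₁, hS₁, hE₁, -⟩ :=
    exists_prefix_exit (A := {v | v - c ∉ box 2 (a' - 1)}) P hzA huA
  have hwbox : w - c ∈ box 2 (a' - 1) := not_not.1 hw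
  have hxa : x - c ∈ box 2 a' := by
    have := ZdPivotal.sub_mem_box_succ_of_adj hwbox hxw.symm
    rwa [Nat.sub_add_cancel ha] at this
  have hxs : x - c ∈ siteSphere a' := Finset.mem_sdiff.2 ⟨hxa, hA₁ x q₁.end_mem_support⟩
  -- Step 2: on the reversed segment `x ⟶ z`, the initial piece inside `c + B(b')`
  have hxB : x ∈ ({v | v - c ∈ box 2 b'} : Set (Site 2)) := box_mono 2 hab hxa
  have hzB : z ∉ ({v | v - c ∈ box 2 b'} : Set (Site 2)) := hz
  obtain ⟨y, w', q₂, hyw', hw', hA₂, hS₂, hE₂, -⟩ :=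
    exists_prefix_exit (A := {v | v - c ∈ box 2 b'}) q₁.reverse hxB hzB
  have hybox : y - c ∈ box 2 b' := hA₂ y q₂.end_mem_support
  have hw'out : w' - c ∉ box 2 b' := hw'
  have hys : y - c ∈ siteSphere b' := by
    refine Finset.mem_sdiff.2 ⟨hybox, fun hyb => hw'out ?_⟩
    have := ZdPivotal.sub_mem_box_succ_of_adj hyb hyw'
    rcases Nat.eq_zero_or_pos b' with hb0 | hb0
    · omega
    · rwa [Nat.sub_add_cancel hb0] at this
  refine ⟨x, y, q₂, hxs, hys, fun v hv => ?_, fun v hv => ?_, fun e he => ?_⟩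
  · have hv1 : v ∈ q₁.support := by
      have := hS₂ v hv
      rwa [SimpleGraph.Walk.support_reverse, List.mem_reverse] at this
    simp only [sqAnnulus, Finset.mem_coe, mem_annulus]
    exact ⟨hA₂ v hv, hA₁ v hv1⟩
  · have hv1 : v ∈ q₁.support := by
      have := hS₂ v hv
      rwa [SimpleGraph.Walk.support_reverse, List.mem_reverse] at this
    exact hS₁ v hv1
  · have he1 : e ∈ q₁.edges := by
      have := hE₂ e he
      rwa [SimpleGraph.Walk.edges_reverse, List.mem_reverse] at this
    exact hE₁ e he1

/-! ### A pivotal block carries four alternating arms -/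

section FourArms

variable {n : ℕ} {c : Site 2} {t n' : ℕ}

/-- **The geometric standing assumption** on a centre `c` and a radius `r`:
`c + B(r) ⊆ [1, 4n-2]²`, i.e. `r + 1 ≤ cᵢ` and `cᵢ + r + 2 ≤ 4n` — so that the square meets neither
the wired left column `{x₀ = 0}`, nor the dual-wired sides, nor the column `{x₀ = 4n-1}`, and the
left column and the column `{x₀ = 4n-1}` are at sup-distance `> r` from `c`. [folklore] -/
def BoxInside (n : ℕ) (c : Site 2) (r : ℕ) : Prop :=
  ∀ i : Fin 2, (r : ℤ) + 1 ≤ c i ∧ c i + r + 2 ≤ 4 * n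

/-- `BoxInside` is monotone: a smaller square around the same centre is inside as well. [folklore] -/
theorem BoxInside.mono {r r' : ℕ} (h : BoxInside n c r) (hr : r' ≤ r) : BoxInside n c r' := fun i => by
  have := h i
  constructor <;> omega

/-- A site of `c + B(r)` has coordinates in `[1, 4n-2]`. [folklore] -/
theorem BoxInside.coord_bounds (hc : BoxInside n c n') {v : Site 2}
    (hv : v - c ∈ box 2 n') (i : Fin 2) : 1 ≤ v i ∧ v i + 2 ≤ 4 * n := by
  have h := (mem_box.1 hv) i
  have hci := hc i
  simp only [Pi.sub_apply] at h
  constructor <;> omega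

/-- A site of `c + B(r)` is a site of the square, off the column `{x₀ = 4n-1}`, off the dual-wired
sides and off the wired left column. [folklore] -/
theorem BoxInside.site_props (hn : 1 ≤ n) (hc : BoxInside n c n') {v : Site 2}
    (hv : v - c ∈ box 2 n') :
    v ∈ squareSites (4 * n) ∧ v 0 + 1 ≤ 4 * n ∧ v ∉ (squareDobrushin (4 * n)).zdArcB ∧
      v ∉ (squareDobrushin (4 * n)).zdArcA := by
  have hb := fun i => hc.coord_bounds hv i
  have hsq : v ∈ squareSites (4 * n) := fun i =>
    ⟨by linarith [(hb i).1], by have := (hb i).2; push_cast; linarith⟩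
  have hL : 1 ≤ 4 * n := by omega
  refine ⟨hsq, by linarith [(hb 0).2], fun hB => ?_, fun hA => ?_⟩
  · rw [mem_zdArcB_squareDobrushin_iff hL] at hB
    obtain ⟨⟨-, i, hi | hi⟩, -⟩ := hB
    · linarith [(hb i).1]
    · have := (hb i).2
      push_cast at this hi
      linarith
  · rw [mem_zdArcA_squareDobrushin_iff hL] at hA
    linarith [(hb 0).1, hA.2]

/-- The left column is at sup-distance `> r` from the centre. [folklore] -/
theorem BoxInside.sub_notMem_box_of_apply_zero_eq_zero (hc : BoxInside n c n') {a : Site 2}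
    (ha : a 0 = 0) : a - c ∉ box 2 n' := fun h => by
  have := (mem_box.1 h) 0
  simp only [Pi.sub_apply] at this
  linarith [(hc 0).1, this.1]

/-- The column `{x₀ = 4n-1}` is at sup-distance `> r` from the centre. [folklore] -/
theorem BoxInside.sub_notMem_box_of_apply_zero_succ (hc : BoxInside n c n') {b : Site 2}
    (hb : b 0 + 1 = ((4 * n : ℕ) : ℤ)) : b - c ∉ box 2 n' := fun h => by
  have := (mem_box.1 h) 0
  simp only [Pi.sub_apply] at this
  push_cast at hb
  linarith [(hc 0).2, this.2]

/-- **An edge of a completed-open walk off a set of opened pairs is genuinely open**: an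
`ω ∪ B`-completed-open lattice pair with an endpoint in `c + B(r)` (hence off the wired column),
not in `B`, lies in `ω`. [folklore] -/
theorem BoxInside.mem_of_bc_union (hn : 1 ≤ n) (hc : BoxInside n c n') {ω : BondConfig (Site 2)}
    {B : Set (Sym2 (Site 2))} {u v : Site 2} (hu : u - c ∈ box 2 n')
    (he : s(u, v) ∈ (squareDobrushin (4 * n)).bcBondConfig (ω ∪ B)) (heB : s(u, v) ∉ B) :
    s(u, v) ∈ ω := by
  rw [DiscreteDobrushin.mem_bcBondConfig_iff] at he
  rcases he.2 with hA | ⟨hω, -⟩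
  · exact absurd (hA u (Sym2.mem_mk_left _ _)) (hc.site_props hn hu).2.2.2
  · rcases hω with hω | hω
    · exact hω
    · exact absurd hω heB

/-- **A genuinely open edge between sites of `c + B(r)` is completed-open.** [folklore] -/
theorem BoxInside.mem_bcBondConfig (hn : 1 ≤ n) (hc : BoxInside n c n') {ω : BondConfig (Site 2)}
    {u v : Site 2} (huv : (zdGraph 2).Adj u v) (hu : u - c ∈ box 2 n') (hv : v - c ∈ box 2 n')
    (he : s(u, v) ∈ ω) : s(u, v) ∈ (squareDobrushin (4 * n)).bcBondConfig ω := by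
  have hpu := hc.site_props hn hu
  have hpv := hc.site_props hn hv
  exact mem_bcBondConfig_squareDobrushin huv hpu.1 hpv.1 hpu.2.2.1 hpv.2.2.1 he

/-- **A pivotal block carries four alternating arms** (Garban: "`Q_j` is pivotal for `X` if and
only if there are two open arms connecting `∂Q_j` to `∂₀Q` and `∂₂Q`, and two dual closed arms
connecting `∂Q_j` to `∂₁Q` and `∂₃Q`", direction `⇒`, cluster form). Let `ω` be a lattice
configuration in `boxPivotal (4n) c t`, `t + 1 ≤ n'`, and `c + B(n') ⊆ [1, 4n-2]²`. The open
crossing of `Q` in `ω ∪ boxPairs c t` must use a pair of the block (else it crosses `Q` in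
`ω ∖ boxPairs c t`); its initial segment from the left column to the block and its final segment
from the block to `{x₀ = 4n-1}` are `ω`-open off the block and cross the annulus `c + A_{t+1,n'}`
inward, giving two open crossings of the annulus; were their inner endpoints joined by an open path
of the annulus, the two segments and that path would cross `Q` in `ω ∖ boxPairs c t`. [cite: SchrammSmirnov2011, Appendix B, proof of Lemma B.1 (Q_j pivotal iff four arms)] -/
theorem boxPivotal_subset_fourArmTwoClustersAt (hn : 1 ≤ n) (ht : t + 1 ≤ n') (hc : BoxInside n c n')
    {ω : BondConfig (Site 2)} (hω : ω ⊆ (zdGraph 2).edgeSet) (h : ω ∈ boxPivotal (4 * n) c t) :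
    ω ∈ fourArmTwoClustersAt c (t + 1) n' := by
  set L := 4 * n with hL
  set B : Set (Sym2 (Site 2)) := boxPairs c t with hB
  obtain ⟨hR, hN⟩ := h
  obtain ⟨a, b, W, ha, hb, hWs, hWe⟩ := hR
  have ht1 : 1 ≤ t + 1 := by omega
  -- the region of the annulus and its basic properties
  set A : Set (Site 2) := (· + c) '' sqAnnulus (t + 1) n' with hA
  have hmemA : ∀ v : Site 2, v - c ∈ sqAnnulus (t + 1) n' → v ∈ A := fun v hv =>
    ⟨v - c, hv, sub_add_cancel v c⟩
  have hAbox : ∀ v ∈ A, v - c ∈ box 2 n' := by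
    rintro v ⟨w, hw, rfl⟩
    simp only [add_sub_cancel_right]
    simp only [sqAnnulus, Finset.mem_coe, mem_annulus] at hw
    exact hw.1
  have hAnotB : ∀ v ∈ A, v - c ∉ box 2 t := by
    rintro v ⟨w, hw, rfl⟩
    simp only [add_sub_cancel_right]
    simp only [sqAnnulus, Finset.mem_coe, mem_annulus, Nat.add_sub_cancel] at hw
    exact hw.2
  -- pairs of the block have both endpoints in `c + B(t)`
  have hpairB : ∀ u v : Site 2, s(u, v) ∈ B → u - c ∈ box 2 t := fun u v huv =>
    (mem_boxPairs_iff.1 huv) u (Sym2.mem_mk_left _ _)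
  -- an edge of `W` whose status is unchanged off the block
  have hstat : ∀ e ∈ W.edges, e ∉ B → (e ∈ ω ∪ B ↔ e ∈ ω \ B) := fun e _ heB =>
    ⟨fun h => ⟨h.resolve_right heB, heB⟩, fun h => Or.inl h.1⟩
  -- Step 1: `W` visits the block
  have hvisit : ∃ z ∈ W.support, z ∈ ({v | v - c ∈ box 2 t} : Set (Site 2)) := by
    by_contra hcon
    simp only [not_exists, not_and] at hcon
    refine hN (squareReach_of_walk_congr W ha hb hWs hWe fun e he => hstat e he fun heB => ?_)
    obtain ⟨d, hd, rfl⟩ := List.mem_map.1 (by rwa [SimpleGraph.Walk.edges] at he)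
    exact hcon _ (W.dart_fst_mem_support_of_mem_darts hd) (hpairB _ _ heB)
  -- the endpoints are far from the block
  have ha_far : a - c ∉ box 2 n' := hc.sub_notMem_box_of_apply_zero_eq_zero ha
  have hb_far : b - c ∉ box 2 n' := hc.sub_notMem_box_of_apply_zero_succ hb
  -- Step 2: the first arm, from the prefix of `W` up to its first visit of the block
  obtain ⟨v₁, hv₁, P₁, hP₁s, hP₁e, hP₁d⟩ := exists_prefix_first_mem W hvisit
  have hP₁notB : ∀ e ∈ P₁.edges, e ∉ B := fun e he heB => by
    obtain ⟨d, hd, rfl⟩ := List.mem_map.1 (by rwa [SimpleGraph.Walk.edges] at he)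
    exact hP₁d d hd (hpairB _ _ heB)
  obtain ⟨x₁, y₁, q₁, hx₁, hy₁, hq₁A, hq₁S, hq₁E⟩ :=
    exists_crossing_subwalk_at (c := c) ht1 ht P₁ ha_far (by rwa [Nat.add_sub_cancel])
  -- Step 3: the second arm, from the prefix of `W.reverse` up to its first visit of the block
  have hvisit' : ∃ z ∈ W.reverse.support, z ∈ ({v | v - c ∈ box 2 t} : Set (Site 2)) := by
    obtain ⟨z, hz, hzO⟩ := hvisit
    exact ⟨z, by rwa [SimpleGraph.Walk.support_reverse, List.mem_reverse], hzO⟩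
  obtain ⟨v₂, hv₂, P₂, hP₂s, hP₂e, hP₂d⟩ := exists_prefix_first_mem W.reverse hvisit'
  have hP₂notB : ∀ e ∈ P₂.edges, e ∉ B := fun e he heB => by
    obtain ⟨d, hd, rfl⟩ := List.mem_map.1 (by rwa [SimpleGraph.Walk.edges] at he)
    exact hP₂d d hd (hpairB _ _ heB)
  obtain ⟨x₂, y₂, q₂, hx₂, hy₂, hq₂A, hq₂S, hq₂E⟩ :=
    exists_crossing_subwalk_at (c := c) ht1 ht P₂ hb_far (by rwa [Nat.add_sub_cancel])
  -- edges of the two prefixes are `ω`-open between sites of `c + B(n')`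
  have hWe' : ∀ e ∈ W.reverse.edges, e ∈ (squareDobrushin L).bcBondConfig (ω ∪ B) := fun e he => by
    rw [SimpleGraph.Walk.edges_reverse, List.mem_reverse] at he
    exact hWe e he
  have hq₁ω : ∀ e ∈ q₁.edges, e ∈ ω := by
    intro e he
    obtain ⟨d, hd, rfl⟩ := List.mem_map.1 (by rwa [SimpleGraph.Walk.edges] at he)
    have hu : d.fst - c ∈ box 2 n' := by
      have := hq₁A _ (q₁.dart_fst_mem_support_of_mem_darts hd)
      simp only [sqAnnulus, Finset.mem_coe, mem_annulus] at this
      exact this.1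
    exact hc.mem_of_bc_union hn hu (hWe _ (hP₁e _ (hq₁E _ he))) (hP₁notB _ (hq₁E _ he))
  have hq₂ω : ∀ e ∈ q₂.edges, e ∈ ω := by
    intro e he
    obtain ⟨d, hd, rfl⟩ := List.mem_map.1 (by rwa [SimpleGraph.Walk.edges] at he)
    have hu : d.fst - c ∈ box 2 n' := by
      have := hq₂A _ (q₂.dart_fst_mem_support_of_mem_darts hd)
      simp only [sqAnnulus, Finset.mem_coe, mem_annulus] at this
      exact this.1
    exact hc.mem_of_bc_union hn hu (hWe' _ (hP₂e _ (hq₂E _ he))) (hP₂notB _ (hq₂E _ he))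
  -- Step 4: the two crossings, and their non-connection inside the annulus
  refine ⟨x₁, hx₁, x₂, hx₂, y₁, hy₁, y₂, hy₂,
    mem_openConnIn_of_walk q₁ (fun v hv => hmemA v (hq₁A v hv)) hq₁ω,
    mem_openConnIn_of_walk q₂ (fun v hv => hmemA v (hq₂A v hv)) hq₂ω, fun hconn => hN ?_⟩
  obtain ⟨R, hRs, hRe⟩ := exists_walk_of_mem_openConnIn hω hconn
  -- the junction walk `a ⟶ x₁ ⟶ x₂ ⟶ b`
  have hx₁P : x₁ ∈ P₁.support := hq₁S x₁ q₁.start_mem_support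
  have hx₂P : x₂ ∈ P₂.support := hq₂S x₂ q₂.start_mem_support
  set T : (zdGraph 2).Walk a b :=
    ((P₁.takeUntil x₁ hx₁P).append R).append (P₂.takeUntil x₂ hx₂P).reverse with hT
  refine ⟨a, b, T, ha, hb, fun z hz => ?_, fun e he => ?_⟩
  · -- vertices: on `W` or in the annulus region
    rw [hT, SimpleGraph.Walk.support_append, SimpleGraph.Walk.support_append,
      SimpleGraph.Walk.support_reverse] at hz
    simp only [List.mem_append] at hz
    rcases hz with (hz | hz) | hz
    · exact hWs z (hP₁s z (P₁.support_takeUntil_subset_support hx₁P hz))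
    · have := hc.site_props hn (hAbox z (hRs z (List.mem_of_mem_tail hz)))
      exact ⟨this.1, this.2.1⟩
    · have hz' : z ∈ W.support := by
        have := hP₂s z (P₂.support_takeUntil_subset_support hx₂P
          (List.mem_reverse.1 (List.mem_of_mem_tail hz)))
        rwa [SimpleGraph.Walk.support_reverse, List.mem_reverse] at this
      exact hWs z hz'
  · -- edges: completed-open in `ω ∖ B`
    rw [hT, SimpleGraph.Walk.edges_append, SimpleGraph.Walk.edges_append,
      SimpleGraph.Walk.edges_reverse] at he
    simp only [List.mem_append, List.mem_reverse] at he
    rcases he with (he | he) | he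
    · have he' : e ∈ P₁.edges := P₁.edges_takeUntil_subset_edges hx₁P he
      exact (mem_bcBondConfig_congr _ (hstat e (hP₁e e he') (hP₁notB e he'))).1 (hWe e (hP₁e e he'))
    · -- an `ω`-open edge of the annulus region: off the block, between interior sites
      obtain ⟨d, hd, rfl⟩ := List.mem_map.1 (by rwa [SimpleGraph.Walk.edges] at he)
      have hu := hRs _ (R.dart_fst_mem_support_of_mem_darts hd)
      have hv := hRs _ (R.dart_snd_mem_support_of_mem_darts hd)
      have heB : s(d.fst, d.snd) ∉ B := fun heB => hAnotB _ hu (hpairB _ _ heB)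
      exact hc.mem_bcBondConfig hn d.adj (hAbox _ hu) (hAbox _ hv) ⟨hRe _ he, heB⟩
    · have he' : e ∈ P₂.edges := P₂.edges_takeUntil_subset_edges hx₂P he
      exact (mem_bcBondConfig_congr _ (hstat e (by
        have := hP₂e e he'
        rwa [SimpleGraph.Walk.edges_reverse, List.mem_reverse] at this) (hP₂notB e he'))).1
        (hWe' e (hP₂e e he'))

/-- **`P(block pivotal) ≤ P⁴`**: for `t + 1 ≤ n'` and `c + B(n') ⊆ [1, 4n-2]²`,
`P_p(boxPivotal (4n) c t) ≤ P_p(fourArmTwoClusters (t+1) n')` (the inclusion holds for lattice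
configurations, i.e. almost surely, and the four-arm probability is translation invariant).
[cite: SchrammSmirnov2011, Appendix B, (B.2) (the direction P[Q_j pivotal] ≲ P⁴)] -/
theorem real_boxPivotal_le (p : unitInterval) (hn : 1 ≤ n) (ht : t + 1 ≤ n') (hc : BoxInside n c n') :
    (bondPercolation (zdGraph 2) p).real (boxPivotal (4 * n) c t) ≤
      (bondPercolation (zdGraph 2) p).real (fourArmTwoClusters (t + 1) n') := by
  rw [← real_fourArmTwoClustersAt p c]
  have hae : boxPivotal (4 * n) c t ≤ᵐ[bondPercolation (zdGraph 2) p] fourArmTwoClustersAt c (t + 1) n' :=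
    (ae_subset_edgeSet (zdGraph 2) p).mono fun ω hω h =>
      boxPivotal_subset_fourArmTwoClustersAt hn ht hc hω h
  exact ENNReal.toReal_mono (measure_ne_top _ _) (measure_mono_ae hae)

end FourArms

end Literature.Probability.Percolation
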